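import Mathlib
import Summits.ValiantsHypothesis.ValiantsHypothesis.Theorems.LiouvilleSarnakAlignedCutRank
import Summits.ValiantsHypothesis.ValiantsHypothesis.Theorems.LiouvilleSarnakLiouvilleCutRankRatioWitness
import HarnessLib

/-!
# Route LiouvilleSarnak — crux `LiouvilleCutRank` (stmt-ValiantsHypothesis-14775):
# CYCLE CERTIFICATES — rows of a cut matrix separated WITHOUT naming the separating column

The tree's separation tools for the cut matrices `M_π(r,c) = λ(N_π(r,c) + 1)` of ONE arbitrary cut `π`
(`…CertifiedCutPoints`, `…ShiftCertificates`, `…RatioWitness`) all have the shape "at THIS column the two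
rows carry `λ(u)` and `λ(v)` with `d v = c u`, `λ(c) ≠ λ(d)`" — a ONE-column certificate, whose unknown
large factor of `u` cancels because it is the SAME on both rows.

This file adds the closed-walk version.  Take columns `c_0, …, c_{L-1}` and write the entries' arguments on
row `r` as `u_i = s_i k_i` and on row `r'` as `v_i = s'_i k_{σ i}` for a PERMUTATION `σ` of the indices
(the unknown, typically large, rough factors `k_i` are shared CROSSWISE between the columns).  If
`∏_i λ(s_i) λ(s'_i) = -1` then the rows `r, r'` cannot agree at all of `c_0, …, c_{L-1}`
(★ `liouville_cycle_ne`: multiply the `L` equalities `λ(s_i) λ(k_i) = λ(s'_i) λ(k_{σ i})`; the `λ(k_i)`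
cancel as a whole) — although the certificate does NOT say at WHICH column they differ.  `L = 1` is the
ratio witness; `L = 2` (★ `liouville_swap_ne`) is new: e.g. `(u_0, v_0, u_1, v_1) = (88, 576, 216, 704)`
with `k = (11, 1)`: `88 = 8·11`, `704 = 64·11`, `576 = 576·1`, `216 = 216·1` and
`λ(8) λ(576) λ(216) λ(64) = -1`, so `λ(88) = λ(576) ∧ λ(216) = λ(704)` is impossible whatever `λ(11)` is
(`not_liouville_eq_and_eq_example`; rows `9, 23` of the Thue–Morse cut word `RCCRCRRCCR`, columns `7, 15`).

* ★ `card_le_two_pow_rank_of_cycleCertified` / `le_rank_of_cycleCertified` — a set `𝓡` of rows of `M_π`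
  that are pairwise cycle-certified has `#𝓡 ≤ 2^{rank M_π}` (distinct `±1` rows,
  `LiouvilleSarnakAligned.card_image_row_le_two_pow_rank`); `card_le_two_pow_rank_of_rows_ne` is the
  bare "pairwise distinct rows" form for arbitrary (not only prefix) rows.
* `card_le_two_pow_rank_of_witnesses₂` — the prefix-row criterion of `…RatioWitness` with a TWO-column
  disjunctive witness, discharged by `liouville_swap_ne`.

WHY (numerics, this session, folder `numerics/cycle_cert*.py`): in the relaxed model "`f = ±1` with
`f(p m) = -f(m)` only for primes `p ≤ B`" (the census's kit question (7)), a parity conflict on the graph of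
`B`-rough parts IS the exact condition for two rows to be forced distinct, and closed walks are exactly its
odd cycles — so this is the COMPLETE pairwise soft test.  It is strictly stronger than one-column witnesses
(Thue–Morse cut word of length 16, `B = 3`: 21 of 36 prefix-row pairs certified vs 14; `B = 7`: 31 vs 27),
but with `B` fixed the largest pairwise-certified family of prefix rows STALLS: `B = 7` gives cliques
`7, 7, 8, 8` (TM, `2n = 16, 20, 24, 28`), `7, 8, 8, 8` (Fibonacci), `6, 8, 9, 10` (`(RRC)^m`), `8–10` (random
words with runs `≤ 2` or `≤ 3`); `B = 31` gives `12–14` at `2n = 24, 28`; among ALL `2^n` rows at `2n = 12`,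
`B = 7` certifies only `690/2016` (TM), `2488/32640` (Fibonacci) pairs, cliques `14, 10`.  So soft
certificates with a bounded prime budget separate `O_B(log n)` rows at best: a proof of the crux along these
lines needs either an unbounded budget with a UNIFORM reason for the parities, or input on `λ` beyond
complete multiplicativity.  Honest framing: a criterion for ONE cut at ONE level; `LiouvilleCutRank`,
`DigitalBilinearLiouville`, `AlgebraicSarnak` stay OPEN; nothing bears on `VP ≠ VNP`.  No definitions.
-/

set_option linter.dupNamespace false

noncomputable section

namespace Summit.ValiantsHypothesis.ValiantsHypothesis.Theorems.LiouvilleSarnakLiouvilleCutRank.CycleCertificates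

open ArithmeticFunction Finset

open Summit.ValiantsHypothesis.ValiantsHypothesis.Theorems.LiouvilleSarnakAligned
  (card_image_row_le_two_pow_rank)
open Summit.ValiantsHypothesis.ValiantsHypothesis.Theorems.LiouvilleSarnakLiouvilleCutRank.RatioWitness
  (card_le_two_pow_rank_of_witnesses)

/-! ### §1 The parity argument -/

/-- `λ(u) = ±1` for `u ≠ 0`. [folklore] -/
theorem liouville_eq_one_or {u : ℕ} (hu : u ≠ 0) : liouville u = 1 ∨ liouville u = -1 := by
  rw [liouville_apply hu]
  exact neg_one_pow_eq_or ℤ _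

/-- ★ **Cycle certificate.**  Let `σ` be a permutation of `Fin L` and `u_i = s_i k_i`, `v_i = s'_i k_{σ i}`
with all `u_i ≠ 0`.  If `∏_i λ(s_i) λ(s'_i) = -1` then NOT all `λ(u_i) = λ(v_i)`: multiplying the `L`
equalities `λ(s_i) λ(k_i) = λ(s'_i) λ(k_{σ i})` and cancelling `∏ λ(k_i) = ∏ λ(k_{σ i}) ≠ 0` gives
`∏ λ(s_i) = ∏ λ(s'_i)`, whose product with itself is a square, not `-1`. [this file] -/
theorem liouville_cycle_ne {L : ℕ} (σ : Equiv.Perm (Fin L)) (u v s s' k : Fin L → ℕ)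
    (hu : ∀ i, u i = s i * k i) (hv : ∀ i, v i = s' i * k (σ i)) (hu0 : ∀ i, u i ≠ 0)
    (hodd : ∏ i, liouville (s i) * liouville (s' i) = -1) :
    ¬ ∀ i, liouville (u i) = liouville (v i) := by
  intro heq
  have hk0 : ∀ i, k i ≠ 0 := fun i h => hu0 i (by rw [hu i, h, mul_zero])
  -- products of the equalities
  have hprod : (∏ i, liouville (s i)) * ∏ i, liouville (k i) =
      (∏ i, liouville (s' i)) * ∏ i, liouville (k i) := by
    have h1 : ∏ i, liouville (u i) = ∏ i, liouville (v i) :=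
      Finset.prod_congr rfl fun i _ => heq i
    have h2 : ∏ i, liouville (u i) = (∏ i, liouville (s i)) * ∏ i, liouville (k i) := by
      rw [← Finset.prod_mul_distrib]
      exact Finset.prod_congr rfl fun i _ => by rw [hu i, liouville_apply_mul]
    have h3 : ∏ i, liouville (v i) = (∏ i, liouville (s' i)) * ∏ i, liouville (k (σ i)) := by
      rw [← Finset.prod_mul_distrib]
      exact Finset.prod_congr rfl fun i _ => by rw [hv i, liouville_apply_mul]
    have h4 : ∏ i, liouville (k (σ i)) = ∏ i, liouville (k i) :=
      Equiv.prod_comp σ (fun i => liouville (k i))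
    rw [← h2, h1, h3, h4]
  have hK : (∏ i, liouville (k i)) ≠ 0 :=
    Finset.prod_ne_zero_iff.mpr fun i _ => liouville_ne_zero (hk0 i)
  have hss : ∏ i, liouville (s i) = ∏ i, liouville (s' i) := mul_right_cancel₀ hK hprod
  rw [Finset.prod_mul_distrib, hss] at hodd
  have hsq : (0 : ℤ) ≤ (∏ i, liouville (s' i)) * ∏ i, liouville (s' i) := mul_self_nonneg _
  omega

/-- **One column (`L = 1`): the ratio witness in factored form.**  `u = s k`, `v = s' k`, `u ≠ 0`,
`λ(s) λ(s') = -1` ⟹ `λ(u) ≠ λ(v)`. [folklore] -/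
theorem liouville_ratio_ne {u v s s' k : ℕ} (hu : u = s * k) (hv : v = s' * k) (hu0 : u ≠ 0)
    (hodd : liouville s * liouville s' = -1) : liouville u ≠ liouville v := by
  intro h
  refine liouville_cycle_ne (L := 1) (Equiv.refl _) (fun _ => u) (fun _ => v) (fun _ => s)
    (fun _ => s') (fun _ => k) (fun _ => hu) (fun _ => hv) (fun _ => hu0) ?_ (fun _ => h)
  simp [hodd]

/-- ★ **Two columns (`L = 2`): the swap certificate.**  `u₀ = s₀ k₀`, `v₀ = s'₀ k₁`, `u₁ = s₁ k₁`,
`v₁ = s'₁ k₀` (the rough parts are exchanged between the two columns), `u₀, u₁ ≠ 0`, and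
`λ(s₀) λ(s'₀) λ(s₁) λ(s'₁) = -1` ⟹ NOT (`λ(u₀) = λ(v₀)` and `λ(u₁) = λ(v₁)`). [this file] -/
theorem liouville_swap_ne {u₀ v₀ u₁ v₁ s₀ s'₀ s₁ s'₁ k₀ k₁ : ℕ}
    (hu₀ : u₀ = s₀ * k₀) (hv₀ : v₀ = s'₀ * k₁) (hu₁ : u₁ = s₁ * k₁) (hv₁ : v₁ = s'₁ * k₀)
    (hu₀0 : u₀ ≠ 0) (hu₁0 : u₁ ≠ 0)
    (hodd : liouville s₀ * liouville s'₀ * liouville s₁ * liouville s'₁ = -1) :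
    ¬ (liouville u₀ = liouville v₀ ∧ liouville u₁ = liouville v₁) := by
  rintro ⟨h₀, h₁⟩
  refine liouville_cycle_ne (L := 2) (Equiv.swap 0 1) ![u₀, u₁] ![v₀, v₁] ![s₀, s₁] ![s'₀, s'₁]
    ![k₀, k₁] ?_ ?_ ?_ ?_ ?_
  · intro i; fin_cases i
    · simpa using hu₀
    · simpa using hu₁
  · intro i; fin_cases i
    · simpa using hv₀
    · simpa using hv₁
  · intro i; fin_cases i
    · simpa using hu₀0
    · simpa using hu₁0
  · rw [Fin.prod_univ_two]
    simp only [Matrix.cons_val_zero, Matrix.cons_val_one]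
    rw [← hodd]; ring
  · intro i; fin_cases i
    · simpa using h₀
    · simpa using h₁

/-- `λ(2^j) = (-1)^j`. [folklore] -/
theorem liouville_two_pow (j : ℕ) : liouville (2 ^ j) = (-1) ^ j := by
  have := Summit.ValiantsHypothesis.ValiantsHypothesis.Theorems.LiouvilleSarnakAligned.liouville_two_pow_mul j 1
  rw [mul_one, liouville_apply_one, mul_one] at this
  exact this

/-- `λ(3) = -1`. [folklore] -/
theorem liouville_three : liouville 3 = -1 := by
  rw [liouville_apply (by norm_num), cardFactors_apply_prime Nat.prime_three]; norm_num

/-- `λ(2^a 3^b) = (-1)^(a+b)`. [folklore] -/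
theorem liouville_two_pow_mul_three_pow (a b : ℕ) :
    liouville (2 ^ a * 3 ^ b) = (-1) ^ (a + b) := by
  rw [liouville_apply_mul, liouville_two_pow, pow_add]
  congr 1
  induction b with
  | zero => simp [liouville_apply_one]
  | succ b ih => rw [pow_succ, liouville_apply_mul, ih, liouville_three, pow_succ]

/-- **Worked instance** (rows `9, 23` of the Thue–Morse cut word `RCCRCRRCCR`, columns `7` and `15`; no
one-column witness with primes `≤ 3` exists for this pair): `88 = 8·11`, `576 = 2^6 3^2`, `216 = 2^3 3^3`,
`704 = 64·11`, and `λ(8) λ(576) λ(216) λ(64) = -1`, so `λ(88) = λ(576) ∧ λ(216) = λ(704)` is impossible —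
with `λ(11)` never evaluated. [this file] -/
theorem not_liouville_eq_and_eq_example :
    ¬ (liouville 88 = liouville 576 ∧ liouville 216 = liouville 704) := by
  refine liouville_swap_ne (s₀ := 2 ^ 3) (k₀ := 11) (s'₀ := 2 ^ 6 * 3 ^ 2) (k₁ := 1)
    (s₁ := 2 ^ 3 * 3 ^ 3) (s'₁ := 2 ^ 6) (by norm_num) (by norm_num) (by norm_num) (by norm_num)
    (by norm_num) (by norm_num) ?_
  rw [liouville_two_pow, liouville_two_pow_mul_three_pow, liouville_two_pow_mul_three_pow,
    liouville_two_pow]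
  norm_num

/-! ### §2 Rows of the cut matrix -/

/-- **Pairwise distinct rows are at most `2^{rank}`** — for ANY set `𝓡` of rows of the Liouville cut matrix
`M_π` (not only prefix rows) that are pairwise distinct as rows, `#𝓡 ≤ 2^{rank M_π}`
(`LiouvilleSarnakAligned.card_image_row_le_two_pow_rank`: a `±1` matrix has `≤ 2^{rank}` distinct rows).
[folklore] -/
theorem card_le_two_pow_rank_of_rows_ne (n : ℕ) (π : Fin n ⊕ Fin n ≃ Fin (2 * n))
    (𝓡 : Finset (Fin n → Bool))
    (hne : ∀ r ∈ 𝓡, ∀ r' ∈ 𝓡, r ≠ r' →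
      (Matrix.of fun r c : Fin n → Bool =>
        (((liouville (Nat.ofBits (fun k : Fin (2 * n) => Sum.elim r c (π.symm k)) + 1) : ℤ) : ℂ))) r ≠
      (Matrix.of fun r c : Fin n → Bool =>
        (((liouville (Nat.ofBits (fun k : Fin (2 * n) => Sum.elim r c (π.symm k)) + 1) : ℤ) : ℂ))) r') :
    𝓡.card ≤ 2 ^ (Matrix.of fun r c : Fin n → Bool =>
      (((liouville (Nat.ofBits (fun k : Fin (2 * n) => Sum.elim r c (π.symm k)) + 1) : ℤ) : ℂ))).rank := by
  classical
  set M := (Matrix.of fun r c : Fin n → Bool =>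
      (((liouville (Nat.ofBits (fun k : Fin (2 * n) => Sum.elim r c (π.symm k)) + 1) : ℤ) : ℂ))) with hM
  have hpm : ∀ r c, M r c = 1 ∨ M r c = -1 := by
    intro r c
    rw [hM, Matrix.of_apply]
    rcases liouville_eq_one_or (Nat.succ_ne_zero
        (Nat.ofBits (fun k : Fin (2 * n) => Sum.elim r c (π.symm k)))) with h | h
    · left; rw [h]; norm_num
    · right; rw [h]; norm_num
  have hinj : Set.InjOn (fun r => M r) 𝓡 := by
    intro r hr r' hr' h
    by_contra hrr'
    exact hne r hr r' hr' hrr' h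
  calc 𝓡.card = (𝓡.image fun r => M r).card := (Finset.card_image_of_injOn hinj).symm
    _ ≤ (Finset.univ.image fun r => M r).card :=
        Finset.card_le_card (Finset.image_subset_image (Finset.subset_univ _))
    _ ≤ 2 ^ M.rank := card_image_row_le_two_pow_rank M hpm

/-- **Two rows with a cycle certificate are distinct rows of `M_π`.**  Columns `c_i`, a permutation `σ`,
and factorizations `N_π(r, c_i) + 1 = s_i k_i`, `N_π(r', c_i) + 1 = s'_i k_{σ i}` with
`∏ λ(s_i) λ(s'_i) = -1`. [this file] -/
theorem rows_ne_of_cycle (n : ℕ) (π : Fin n ⊕ Fin n ≃ Fin (2 * n)) (r r' : Fin n → Bool)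
    {L : ℕ} (σ : Equiv.Perm (Fin L)) (c : Fin L → (Fin n → Bool)) (s s' k : Fin L → ℕ)
    (hu : ∀ i, Nat.ofBits (fun j : Fin (2 * n) => Sum.elim r (c i) (π.symm j)) + 1 = s i * k i)
    (hv : ∀ i, Nat.ofBits (fun j : Fin (2 * n) => Sum.elim r' (c i) (π.symm j)) + 1 = s' i * k (σ i))
    (hodd : ∏ i, liouville (s i) * liouville (s' i) = -1) :
    (Matrix.of fun r c : Fin n → Bool =>
        (((liouville (Nat.ofBits (fun k : Fin (2 * n) => Sum.elim r c (π.symm k)) + 1) : ℤ) : ℂ))) r ≠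
      (Matrix.of fun r c : Fin n → Bool =>
        (((liouville (Nat.ofBits (fun k : Fin (2 * n) => Sum.elim r c (π.symm k)) + 1) : ℤ) : ℂ))) r' := by
  intro heq
  refine liouville_cycle_ne σ
    (fun i => Nat.ofBits (fun j : Fin (2 * n) => Sum.elim r (c i) (π.symm j)) + 1)
    (fun i => Nat.ofBits (fun j : Fin (2 * n) => Sum.elim r' (c i) (π.symm j)) + 1)
    s s' k hu hv (fun i => Nat.succ_ne_zero _) hodd fun i => ?_
  have := congr_fun heq (c i)
  simp only [Matrix.of_apply] at this
  exact_mod_cast this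

/-- ★ **Cycle-certified rows bound the rank from below.**  If the rows in `𝓡` are pairwise cycle-certified
(for `r ≠ r'`: columns `c_i`, a permutation `σ` of their indices and factorizations
`N_π(r, c_i) + 1 = s_i k_i`, `N_π(r', c_i) + 1 = s'_i k_{σ i}` with `∏ λ(s_i) λ(s'_i) = -1`), then
`#𝓡 ≤ 2^{rank M_π}`. [this file] -/
theorem card_le_two_pow_rank_of_cycleCertified (n : ℕ) (π : Fin n ⊕ Fin n ≃ Fin (2 * n))
    (𝓡 : Finset (Fin n → Bool))
    (hcert : ∀ r ∈ 𝓡, ∀ r' ∈ 𝓡, r ≠ r' → ∃ (L : ℕ) (σ : Equiv.Perm (Fin L))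
      (c : Fin L → (Fin n → Bool)) (s s' k : Fin L → ℕ),
      (∀ i, Nat.ofBits (fun j : Fin (2 * n) => Sum.elim r (c i) (π.symm j)) + 1 = s i * k i) ∧
      (∀ i, Nat.ofBits (fun j : Fin (2 * n) => Sum.elim r' (c i) (π.symm j)) + 1 = s' i * k (σ i)) ∧
      ∏ i, liouville (s i) * liouville (s' i) = -1) :
    𝓡.card ≤ 2 ^ (Matrix.of fun r c : Fin n → Bool =>
      (((liouville (Nat.ofBits (fun k : Fin (2 * n) => Sum.elim r c (π.symm k)) + 1) : ℤ) : ℂ))).rank := by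
  refine card_le_two_pow_rank_of_rows_ne n π 𝓡 fun r hr r' hr' hrr' => ?_
  obtain ⟨L, σ, c, s, s', k, hu, hv, hodd⟩ := hcert r hr r' hr' hrr'
  exact rows_ne_of_cycle n π r r' σ c s s' k hu hv hodd

/-- The `W ≤ rank` form of `card_le_two_pow_rank_of_cycleCertified`. [this file] -/
theorem le_rank_of_cycleCertified (n W : ℕ) (π : Fin n ⊕ Fin n ≃ Fin (2 * n))
    (𝓡 : Finset (Fin n → Bool)) (hW : 2 ^ W ≤ 𝓡.card)
    (hcert : ∀ r ∈ 𝓡, ∀ r' ∈ 𝓡, r ≠ r' → ∃ (L : ℕ) (σ : Equiv.Perm (Fin L))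
      (c : Fin L → (Fin n → Bool)) (s s' k : Fin L → ℕ),
      (∀ i, Nat.ofBits (fun j : Fin (2 * n) => Sum.elim r (c i) (π.symm j)) + 1 = s i * k i) ∧
      (∀ i, Nat.ofBits (fun j : Fin (2 * n) => Sum.elim r' (c i) (π.symm j)) + 1 = s' i * k (σ i)) ∧
      ∏ i, liouville (s i) * liouville (s' i) = -1) :
    W ≤ (Matrix.of fun r c : Fin n → Bool =>
      (((liouville (Nat.ofBits (fun k : Fin (2 * n) => Sum.elim r c (π.symm k)) + 1) : ℤ) : ℂ))).rank :=
  (Nat.pow_le_pow_iff_right (by norm_num)).mp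
    (hW.trans (card_le_two_pow_rank_of_cycleCertified n π 𝓡 hcert))

/-! ### §3 Prefix rows: the two-column witness form of `…RatioWitness` -/

/-- **Prefix rows with TWO-column witnesses.**  As in `RatioWitness.card_le_two_pow_rank_of_witnesses`,
but for each pair `p < p'` of cut points it suffices to give two numbers `Y₁, Y₂` with bits at column
positions `p + b` such that NOT both `λ(Y₁ + 1 + m) = λ(Y₁ + 1)` and `λ(Y₂ + 1 + m) = λ(Y₂ + 1)`
(`m = Σ 2^{j-p}` over the row positions `j ∈ [p, p')`) — e.g. by `liouville_swap_ne`.  Then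
`#P ≤ 2^{rank M_π}`. [this file] -/
theorem card_le_two_pow_rank_of_witnesses₂ (n : ℕ) (π : Fin n ⊕ Fin n ≃ Fin (2 * n)) (P : Finset ℕ)
    (hP : ∀ p ∈ P, p ≤ 2 * n)
    (hwit : ∀ p ∈ P, ∀ p' ∈ P, p < p' → ∃ Y₁ Y₂ : ℕ,
      (∀ b : ℕ, Y₁.testBit b = true → ∃ i : Fin n, (π (Sum.inr i) : ℕ) = p + b) ∧
      (∀ b : ℕ, Y₂.testBit b = true → ∃ i : Fin n, (π (Sum.inr i) : ℕ) = p + b) ∧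
      ¬ (liouville (Y₁ + 1 + ∑ j : Fin (2 * n),
          (if p ≤ (j : ℕ) ∧ (j : ℕ) < p' ∧ (π.symm j).isLeft = true then 2 ^ ((j : ℕ) - p) else 0)) =
          liouville (Y₁ + 1) ∧
        liouville (Y₂ + 1 + ∑ j : Fin (2 * n),
          (if p ≤ (j : ℕ) ∧ (j : ℕ) < p' ∧ (π.symm j).isLeft = true then 2 ^ ((j : ℕ) - p) else 0)) =
          liouville (Y₂ + 1))) :
    P.card ≤ 2 ^ (Matrix.of fun r c : Fin n → Bool =>
      (((liouville (Nat.ofBits (fun k : Fin (2 * n) => Sum.elim r c (π.symm k)) + 1) : ℤ) : ℂ))).rank := by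
  refine card_le_two_pow_rank_of_witnesses n π P hP fun p hp p' hp' hpp' => ?_
  obtain ⟨Y₁, Y₂, hb₁, hb₂, hnot⟩ := hwit p hp p' hp' hpp'
  by_cases h₁ : liouville (Y₁ + 1 + ∑ j : Fin (2 * n),
      (if p ≤ (j : ℕ) ∧ (j : ℕ) < p' ∧ (π.symm j).isLeft = true then 2 ^ ((j : ℕ) - p) else 0)) =
      liouville (Y₁ + 1)
  · exact ⟨Y₂, hb₂, fun h₂ => hnot ⟨h₁, h₂⟩⟩
  · exact ⟨Y₁, hb₁, h₁⟩


/-! ### §4 (appended) Class cycles — the GLOBAL form of the certificate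

A pairwise-certified family of rows only bounds the rank through a CLIQUE of the certified graph.  The
closed walk of `liouville_cycle_ne` may instead run through SEVERAL pairs of rows `(a_i, b_i)` (one pair per
column `c_i`, the rough parts chained across the pairs): if the partition of the rows into the classes of
equal rows put every `a_i` with its `b_i`, all `λ(u_i) = λ(v_i)` would hold — impossible when the smooth
parity is odd.  Hence: if EVERY labelling of the rows by `K` labels admits such a class cycle with
`label(a_i) = label(b_i)`, the cut matrix has MORE than `K` distinct rows, so `K < 2^{rank M_π}`
(★ `lt_two_pow_rank_of_classCycles`).  In the relaxed model "free sign per `B`-rough part" this is the EXACT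
obstruction to realising a partition (an affine system over `𝔽₂` is inconsistent iff its constraint graph has
an odd cycle), and it is much stronger than cliques: exact minima of the number of row classes in that model,
ALL `2^n` rows (this session, `numerics/relaxed_exact3.py`, branch and bound): Thue–Morse cut words, `B = 7`:
`13, 24` at `2n = 8, 10` (`≤ 44` at `12`) against pairwise cliques `8, 12, 14`; `B = 3`: `5, 7, 9`;
`(CR)^n`, `B = 3`: exactly `n + 1 = 5, 6, 7`; `B = 2` collapses all prefix rows to `2` classes (the `2`-adic
twin).  So the `7`-smooth structure of `[1, 4^n]` alone forces `≈ 0.7 · 2^n` distinct rows on these small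
Thue–Morse cuts: a soft proof of the crux is NOT excluded by the relaxed model — what is missing is a uniform
way to exhibit class cycles, not arithmetic input. -/

/-- **Class cycles separate some pair.**  Rows `a_i, b_i`, columns `c_i`, a permutation `σ` and
factorizations `N_π(a_i, c_i) + 1 = s_i k_i`, `N_π(b_i, c_i) + 1 = s'_i k_{σ i}` with
`∏ λ(s_i) λ(s'_i) = -1` ⟹ for some `i` the rows `a_i`, `b_i` of `M_π` are distinct. [this file] -/
theorem exists_rows_ne_of_classCycle (n : ℕ) (π : Fin n ⊕ Fin n ≃ Fin (2 * n))
    {L : ℕ} (σ : Equiv.Perm (Fin L)) (a b c : Fin L → (Fin n → Bool)) (s s' k : Fin L → ℕ)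
    (hu : ∀ i, Nat.ofBits (fun j : Fin (2 * n) => Sum.elim (a i) (c i) (π.symm j)) + 1 = s i * k i)
    (hv : ∀ i, Nat.ofBits (fun j : Fin (2 * n) => Sum.elim (b i) (c i) (π.symm j)) + 1 =
      s' i * k (σ i))
    (hodd : ∏ i, liouville (s i) * liouville (s' i) = -1) :
    ∃ i, (Matrix.of fun r c : Fin n → Bool =>
        (((liouville (Nat.ofBits (fun k : Fin (2 * n) => Sum.elim r c (π.symm k)) + 1) : ℤ) : ℂ))) (a i) ≠
      (Matrix.of fun r c : Fin n → Bool =>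
        (((liouville (Nat.ofBits (fun k : Fin (2 * n) => Sum.elim r c (π.symm k)) + 1) : ℤ) : ℂ))) (b i) := by
  by_contra hall
  push Not at hall
  refine liouville_cycle_ne σ
    (fun i => Nat.ofBits (fun j : Fin (2 * n) => Sum.elim (a i) (c i) (π.symm j)) + 1)
    (fun i => Nat.ofBits (fun j : Fin (2 * n) => Sum.elim (b i) (c i) (π.symm j)) + 1)
    s s' k hu hv (fun i => Nat.succ_ne_zero _) hodd fun i => ?_
  have := congr_fun (hall i) (c i)
  simp only [Matrix.of_apply] at this
  exact_mod_cast this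

/-- ★ **Class cycles bound the number of distinct rows, hence the rank, from below.**  If EVERY labelling
`cls` of the rows of `M_π` by `K` labels admits a class cycle (rows `a_i, b_i` with `cls a_i = cls b_i`,
columns `c_i`, a permutation `σ`, factorizations `N_π(a_i,c_i) + 1 = s_i k_i`,
`N_π(b_i,c_i) + 1 = s'_i k_{σ i}`, `∏ λ(s_i) λ(s'_i) = -1`), then `M_π` has more than `K` distinct rows and
`K < 2^{rank M_π}`: otherwise label each row by (an index of) its row vector. [this file] -/
theorem lt_two_pow_rank_of_classCycles (n K : ℕ) (π : Fin n ⊕ Fin n ≃ Fin (2 * n))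
    (h : ∀ cls : (Fin n → Bool) → Fin K, ∃ (L : ℕ) (σ : Equiv.Perm (Fin L))
      (a b c : Fin L → (Fin n → Bool)) (s s' k : Fin L → ℕ),
      (∀ i, cls (a i) = cls (b i)) ∧
      (∀ i, Nat.ofBits (fun j : Fin (2 * n) => Sum.elim (a i) (c i) (π.symm j)) + 1 = s i * k i) ∧
      (∀ i, Nat.ofBits (fun j : Fin (2 * n) => Sum.elim (b i) (c i) (π.symm j)) + 1 =
        s' i * k (σ i)) ∧
      ∏ i, liouville (s i) * liouville (s' i) = -1) :
    K < 2 ^ (Matrix.of fun r c : Fin n → Bool =>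
      (((liouville (Nat.ofBits (fun k : Fin (2 * n) => Sum.elim r c (π.symm k)) + 1) : ℤ) : ℂ))).rank := by
  classical
  set M := (Matrix.of fun r c : Fin n → Bool =>
      (((liouville (Nat.ofBits (fun k : Fin (2 * n) => Sum.elim r c (π.symm k)) + 1) : ℤ) : ℂ))) with hM
  have hpm : ∀ r c, M r c = 1 ∨ M r c = -1 := by
    intro r c
    rw [hM, Matrix.of_apply]
    rcases liouville_eq_one_or (Nat.succ_ne_zero
        (Nat.ofBits (fun k : Fin (2 * n) => Sum.elim r c (π.symm k)))) with h1 | h1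
    · left; rw [h1]; norm_num
    · right; rw [h1]; norm_num
  -- the set of row vectors
  set S := (Finset.univ : Finset (Fin n → Bool)).image (fun r => M r) with hS
  have hSle : S.card ≤ 2 ^ M.rank := card_image_row_le_two_pow_rank M hpm
  by_contra hK
  push Not at hK
  have hSK : S.card ≤ K := hSle.trans hK
  -- label each row by the index of its row vector
  have hmem : ∀ r : Fin n → Bool, M r ∈ S := fun r =>
    Finset.mem_image_of_mem _ (Finset.mem_univ r)
  let cls : (Fin n → Bool) → Fin K := fun r => Fin.castLE hSK (S.equivFin ⟨M r, hmem r⟩)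
  have hcls : ∀ r r', cls r = cls r' → M r = M r' := by
    intro r r' hrr'
    have h1 : S.equivFin ⟨M r, hmem r⟩ = S.equivFin ⟨M r', hmem r'⟩ :=
      Fin.castLE_injective hSK hrr'
    have h2 := S.equivFin.injective h1
    exact congrArg Subtype.val h2
  obtain ⟨L, σ, a, b, c, s, s', k, hab, hu, hv, hodd⟩ := h cls
  obtain ⟨i, hi⟩ := exists_rows_ne_of_classCycle n π σ a b c s s' k hu hv hodd
  exact hi (hcls _ _ (hab i))

/-- The `W ≤ rank` form: class cycles for every labelling by `2^W - 1` labels give `rank M_π ≥ W`.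
[this file] -/
theorem le_rank_of_classCycles (n W : ℕ) (π : Fin n ⊕ Fin n ≃ Fin (2 * n))
    (h : ∀ cls : (Fin n → Bool) → Fin (2 ^ W - 1), ∃ (L : ℕ) (σ : Equiv.Perm (Fin L))
      (a b c : Fin L → (Fin n → Bool)) (s s' k : Fin L → ℕ),
      (∀ i, cls (a i) = cls (b i)) ∧
      (∀ i, Nat.ofBits (fun j : Fin (2 * n) => Sum.elim (a i) (c i) (π.symm j)) + 1 = s i * k i) ∧
      (∀ i, Nat.ofBits (fun j : Fin (2 * n) => Sum.elim (b i) (c i) (π.symm j)) + 1 =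
        s' i * k (σ i)) ∧
      ∏ i, liouville (s i) * liouville (s' i) = -1) :
    W ≤ (Matrix.of fun r c : Fin n → Bool =>
      (((liouville (Nat.ofBits (fun k : Fin (2 * n) => Sum.elim r c (π.symm k)) + 1) : ℤ) : ℂ))).rank := by
  have hlt := lt_two_pow_rank_of_classCycles n (2 ^ W - 1) π h
  have h1 : 1 ≤ 2 ^ W := Nat.one_le_two_pow
  have h2 : 2 ^ W ≤ 2 ^ (Matrix.of fun r c : Fin n → Bool =>
      (((liouville (Nat.ofBits (fun k : Fin (2 * n) => Sum.elim r c (π.symm k)) + 1) : ℤ) : ℂ))).rank := by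
    omega
  exact (Nat.pow_le_pow_iff_right (by norm_num)).mp h2

end Summit.ValiantsHypothesis.ValiantsHypothesis.Theorems.LiouvilleSarnakLiouvilleCutRank.CycleCertificates
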